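import Summits.PneNP.PneNP.Theorems.SymmetryBudgetNoHiddenOrderReplayIterDefs
import Summits.PneNP.PneNP.Theorems.SymmetryBudgetNoHiddenOrderReplayAtom
import Summits.PneNP.PneNP.Theorems.SymmetryBudgetNoHiddenOrderKitBridgesSelect
import Summits.PneNP.PneNP.Theorems.SymmetryBudgetNoHiddenOrderPerPathAtoms
import Summits.PneNP.PneNP.Theorems.SymmetryBudgetNoHiddenOrderPerPathProcess
import Literature.Combinatorics.SimpleGraph.OrderedRefinementStationary

/-!
# `NoHiddenOrder` (stmt-PneNP-14781), (R2c) replay circuit II: the REPLAY module — semantics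

Route `PneNP/SymmetryBudget`; data in `SymmetryBudgetNoHiddenOrderReplayIterDefs.lean`.  Main results:

* `replay_succ_eq_stepSt` — `BranchSum.replay` is the iteration of `stepSt` (one multiplexed OR-step);
* `stepSt_fst_subset`, `ptr_mem_stepSt`, `inv_stepSt` — the invariants of a step (pointer in the block,
  equitable inside the block, connected switching graph: `equitableIn_refineIn`, `equitableIn_atom`,
  `atom_connected`, `self_mem_atom`);
* the CHOICE LAYER of one stage: `ReplayIter.sem_sel_iff` (the kit's `MinCell` reads the first smallest cell,
  `mem_smallestCell_iff_minCell`), `sem_insel_iff`, `sem_dom_iff` (the dominating label point), `sem_go_iff`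
  (= `StepCond`), `sem_dom_iff_eq`, and the order/kernel of the individualised colouring `sem_ltI_iff`,
  `sem_eqI_iff` (`indiv_lt_iff/indiv_eq_iff`).
The refinement/atom/multiplexer layer of a stage and the induction over stages (`stateReads_replay`) are in
`SymmetryBudgetNoHiddenOrderReplayIterStages.lean`.  Sorry-free; supports stmt-PneNP-14781, does not close it.
-/

set_option linter.dupNamespace false -- `Summit.PneNP.PneNP.…` (D-0017 single-conjunct layout)

namespace Summit.PneNP.PneNP.Theorems

open Finset Literature.Computability.Complexity Literature.Computability.Complexity.SymProg
open Literature.Combinatorics.SimpleGraph (ocrIter)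

/-! ### The step function -/

section Step

variable {V : Type*} [DecidableEq V] {G : SimpleGraph V} [DecidableRel G.Adj] {S : Finset V} {hgt : V → ℕ}
  {ptr : V}

/-- Unfolding `stepSt` when the condition holds. [folklore] -/
theorem stepSt_of_cond {St : Finset V × (V → ℕ)} (h : StepCond S hgt St) :
    stepSt G S hgt ptr St = BranchSum.orStep G ptr St (Finset.card_eq_one.1 h.2).choose := by
  unfold stepSt; rw [dif_pos h]

/-- Unfolding `stepSt` when the condition fails. [folklore] -/
theorem stepSt_of_not_cond {St : Finset V × (V → ℕ)} (h : ¬ StepCond S hgt St) : stepSt G S hgt ptr St = St := by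
  unfold stepSt; rw [dif_neg h]

/-- **`replay` iterates `stepSt`.** [folklore] -/
theorem replay_succ_eq_stepSt (f : ℕ) (St : Finset V × (V → ℕ)) :
    BranchSum.replay G S hgt ptr (f + 1) St = stepSt G S hgt ptr (BranchSum.replay G S hgt ptr f St) := by
  induction f generalizing St with
  | zero =>
    show BranchSum.replay G S hgt ptr 1 St = stepSt G S hgt ptr St
    unfold stepSt StepCond domSet
    rw [BranchSum.replay]
    split_ifs with h <;> rfl
  | succ f ih =>
    rw [BranchSum.replay]
    by_cases h : 2 ≤ St.1.card ∧ ((BranchSum.smallestCell St.1 St.2 ∩ S).filter fun y =>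
        ∀ y' ∈ BranchSum.smallestCell St.1 St.2 ∩ S, y' ≠ y → hgt y' < hgt y).card = 1
    · rw [dif_pos h, ih, BranchSum.replay, dif_pos h]
    · rw [dif_neg h, BranchSum.replay, dif_neg h, stepSt_of_not_cond]
      exact h

/-- `replay k` is the `k`-th iterate of `stepSt`. [folklore] -/
theorem replay_eq_iterate (f : ℕ) (St : Finset V × (V → ℕ)) :
    BranchSum.replay G S hgt ptr f St = (stepSt G S hgt ptr)^[f] St := by
  induction f with
  | zero => rfl
  | succ f ih => rw [replay_succ_eq_stepSt, ih, Function.iterate_succ_apply']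

/-- Membership in the dominating set, unfolded. [folklore] -/
theorem mem_domSet_iff (St : Finset V × (V → ℕ)) (y : V) :
    y ∈ domSet S hgt St ↔ (y ∈ BranchSum.smallestCell St.1 St.2 ∧ y ∈ S) ∧
      ∀ y', y' ∈ BranchSum.smallestCell St.1 St.2 ∧ y' ∈ S → y' ≠ y → hgt y' < hgt y := by
  unfold domSet
  simp only [mem_filter, mem_inter]

/-- Two dominating points cannot coexist: the dominating set has at most one element. [folklore] -/
theorem card_domSet_le_one (St : Finset V × (V → ℕ)) : (domSet S hgt St).card ≤ 1 := by
  rw [Finset.card_le_one]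
  intro a ha b hb
  by_contra hab
  have ha' := (mem_filter.1 ha).2 b (mem_filter.1 hb).1 (Ne.symm hab)
  have hb' := (mem_filter.1 hb).2 a (mem_filter.1 ha).1 hab
  omega

/-- The step condition as "some dominating point exists". [folklore] -/
theorem stepCond_iff (St : Finset V × (V → ℕ)) :
    StepCond S hgt St ↔ 2 ≤ St.1.card ∧ (domSet S hgt St).Nonempty := by
  unfold StepCond
  refine and_congr_right fun _ => ?_
  rw [← Finset.card_pos]
  have := card_domSet_le_one (S := S) (hgt := hgt) St
  omega

/-- Under the condition, the dominating set is the singleton of the chosen point. [folklore] -/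
theorem domSet_eq_singleton {St : Finset V × (V → ℕ)} (h : StepCond S hgt St) :
    domSet S hgt St = {(Finset.card_eq_one.1 h.2).choose} :=
  (Finset.card_eq_one.1 h.2).choose_spec

/-- Under the condition, membership in the dominating set is being the chosen point. [folklore] -/
theorem mem_domSet_iff_eq {St : Finset V × (V → ℕ)} (h : StepCond S hgt St) (u : V) :
    u ∈ domSet S hgt St ↔ u = (Finset.card_eq_one.1 h.2).choose := by
  have hs := domSet_eq_singleton h
  constructor
  · intro hu
    rw [hs] at hu
    exact mem_singleton.1 hu
  · intro hu
    have hmem : (Finset.card_eq_one.1 h.2).choose ∈ ({(Finset.card_eq_one.1 h.2).choose} : Finset V) :=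
      mem_singleton_self _
    rw [← hs] at hmem
    rw [hu]
    exact hmem

/-- The chosen point lies in the block. [folklore] -/
theorem choose_mem {St : Finset V × (V → ℕ)} (h : StepCond S hgt St) :
    (Finset.card_eq_one.1 h.2).choose ∈ St.1 := by
  have : (Finset.card_eq_one.1 h.2).choose ∈ domSet S hgt St := (mem_domSet_iff_eq h _).2 rfl
  exact BranchSum.smallestCell_subset _ _ (mem_inter.1 (mem_filter.1 this).1).1

/-- The step shrinks the block. [folklore] -/
theorem stepSt_fst_subset (St : Finset V × (V → ℕ)) : (stepSt G S hgt ptr St).1 ⊆ St.1 := by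
  by_cases h : StepCond S hgt St
  · rw [stepSt_of_cond h]; exact BranchSum.atom_subset _ _ _
  · rw [stepSt_of_not_cond h]

/-- The pointer stays in the block. [folklore] -/
theorem ptr_mem_stepSt {St : Finset V × (V → ℕ)} (hptr : ptr ∈ St.1) : ptr ∈ (stepSt G S hgt ptr St).1 := by
  by_cases h : StepCond S hgt St
  · rw [stepSt_of_cond h]; exact BranchSum.self_mem_atom _ hptr
  · rw [stepSt_of_not_cond h]; exact hptr

/-- **The invariants persist**: equitable inside the block, connected switching graph. [folklore] -/
theorem inv_stepSt {St : Finset V × (V → ℕ)} (hptr : ptr ∈ St.1) (hinv : EqIn G St.1 St.2 ∧ ConnIn G St.1 St.2) :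
    EqIn G (stepSt G S hgt ptr St).1 (stepSt G S hgt ptr St).2 ∧
      ConnIn G (stepSt G S hgt ptr St).1 (stepSt G S hgt ptr St).2 := by
  by_cases h : StepCond S hgt St
  · rw [stepSt_of_cond h]
    set x₀ := (Finset.card_eq_one.1 h.2).choose
    set c' := BranchSum.refineIn G St.1 (BranchSum.indiv St.2 x₀) with hc'
    show EqIn G (BranchSum.atom G St.1 c' ptr) c' ∧ ConnIn G (BranchSum.atom G St.1 c' ptr) c'
    have heqA : EqIn G St.1 c' := fun u hu u' hu' hcu w hw =>
      BranchSum.equitableIn_refineIn St.1 (BranchSum.indiv St.2 x₀) hu hu' hcu hw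
    exact ⟨fun u hu u' hu' hcu w hw => BranchSum.equitableIn_atom ptr heqA hu hu' hcu hw,
      fun S' hS' hne hSA => BranchSum.atom_connected c' hptr hS' hne hSA⟩
  · rw [stepSt_of_not_cond h]; exact hinv

/-- The invariants persist, in the guarded form. [folklore] -/
theorem inv_stepSt' {St : Finset V × (V → ℕ)} (hptr : ptr ∈ St.1)
    (hinv : 2 ≤ St.1.card → EqIn G St.1 St.2 ∧ ConnIn G St.1 St.2) :
    2 ≤ (stepSt G S hgt ptr St).1.card →
      EqIn G (stepSt G S hgt ptr St).1 (stepSt G S hgt ptr St).2 ∧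
        ConnIn G (stepSt G S hgt ptr St).1 (stepSt G S hgt ptr St).2 := by
  intro h2
  by_cases h : StepCond S hgt St
  · exact inv_stepSt hptr (hinv h.1)
  · rw [stepSt_of_not_cond h] at h2 ⊢; exact hinv h2

end Step

/-! ### One stage of the circuit -/

namespace ReplayIter

variable {ι Λ : Type*} [DecidableEq ι] [DecidableEq Λ] {P : SymProg ι Λ}
variable {V : Type*} [Fintype V] [DecidableEq V] {N T J F : ℕ}
variable {RP : ReplayIter P V N T J F} {x : ι → Bool}
variable {G : SimpleGraph V} [DecidableRel G.Adj]

omit [Fintype V] [DecidableEq V] in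
/-- Cells of the part, counted in the subtype, are the `W`-relative cells (Finset-subtype binder form of
`BranchSum.card_cellOf_eq_cellCard`). [folklore] -/
theorem card_cellOf_eq_cellCard' (W : Finset V) (c : V → ℕ) (u : V) :
    (BranchSum.cellOf W c u).card =
      Literature.Combinatorics.SimpleGraph.cellCard (fun a : ↥W => c a) (c u) :=
  BranchSum.card_cellOf_eq_cellCard W c u

section Stage

variable {k : Fin F} {A : Finset V} {col : V → ℕ}

/-- The part of the stage-`k` cell gadget is the block. [folklore] -/
theorem part_M (hread : RP.StateReads x k.castSucc A col) : (RP.M k).part x = A := by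
  ext u; rw [(RP.M k).mem_part]; show wval x (P.sem x) ((RP.M k).mem u) = true ↔ _
  rw [RP.M_mem]; exact hread.mem_iff u

/-- The stage-`k` cell gadget reads the colouring of the block. [folklore] -/
theorem reads_M (hread : RP.StateReads x k.castSucc A col) :
    (RP.M k).Reads x (fun a : (RP.M k).part x => col a) where
  eq_iff a b := by
    rw [show (RP.M k).eq = RP.eqS k.castSucc from RP.M_eq k]
    exact hread.eq_iff a (part_M hread ▸ a.2) b (part_M hread ▸ b.2)
  lt_iff a b := by
    rw [show (RP.M k).lt = RP.ltS k.castSucc from RP.M_lt k]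
    exact hread.lt_iff a (part_M hread ▸ a.2) b (part_M hread ▸ b.2)

/-- **`sel`** of the stage-`k` cell gadget: for `a ∈ A`, "`A` has at least two vertices and `a` lies in the
first smallest cell" (the invariant excludes singleton cells). [folklore] -/
theorem sem_sel_iff (hread : RP.StateReads x k.castSucc A col) (hinv : 2 ≤ A.card → EqIn G A col ∧ ConnIn G A col)
    (hN : A.card ≤ N) {a : V} (ha : a ∈ A) :
    P.sem x ((RP.M k).sel a) = true ↔ 2 ≤ A.card ∧ a ∈ BranchSum.smallestCell A col := by
  have hpart := part_M hread
  have ha' : a ∈ (RP.M k).part x := hpart ▸ ha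
  rw [MinCell.sem_sel_iff (reads_M hread) (by rw [hpart]; exact hN) ⟨a, ha'⟩]
  simp only [← card_cellOf_eq_cellCard', hpart]
  -- translate the subtype quantifier
  have hq : (∀ b : (RP.M k).part x, 2 ≤ (BranchSum.cellOf A col b).card →
      (BranchSum.cellOf A col a).card < (BranchSum.cellOf A col b).card ∨
        ((BranchSum.cellOf A col a).card = (BranchSum.cellOf A col b).card ∧ col a ≤ col b)) ↔
      ∀ b ∈ A, 2 ≤ (BranchSum.cellOf A col b).card →
        (BranchSum.cellOf A col a).card < (BranchSum.cellOf A col b).card ∨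
          ((BranchSum.cellOf A col a).card = (BranchSum.cellOf A col b).card ∧ col a ≤ col b) :=
    ⟨fun H b hb => H ⟨b, hpart ▸ hb⟩, fun H b => H b (hpart ▸ b.2)⟩
  rw [hq]
  by_cases hA : 2 ≤ A.card
  · obtain ⟨heq, hconn⟩ := hinv hA
    have hbig : ∀ b ∈ A, 2 ≤ (BranchSum.cellOf A col b).card :=
      fun b hb => BranchSum.two_le_card_cellOf (G := G) heq hconn hA hb
    rw [← BranchSum.mem_smallestCell_iff_minCell col hbig ha]
    simp [hA]
  · have hsmall : (BranchSum.cellOf A col a).card < 2 :=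
      lt_of_le_of_lt (card_le_card (filter_subset _ _)) (not_le.1 hA)
    constructor
    · rintro ⟨h2, -⟩; omega
    · rintro ⟨h2, -⟩; exact absurd h2 hA

/-- **`insel k t`**: "`A` has at least two vertices and `t` lies in its first smallest cell". [folklore] -/
theorem sem_insel_iff (hread : RP.StateReads x k.castSucc A col) (hinv : 2 ≤ A.card → EqIn G A col ∧ ConnIn G A col)
    (hN : A.card ≤ N) (t : V) :
    P.sem x (RP.insel k t) = true ↔ 2 ≤ A.card ∧ t ∈ BranchSum.smallestCell A col := by
  rw [P.sem_and (RP.kind_insel k t), RP.srcs_insel]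
  simp only [mem_insert, mem_singleton, forall_eq_or_imp, forall_eq, wval_inr, hread.mem_iff]
  by_cases ht : t ∈ A
  · rw [sem_sel_iff hread hinv hN ht]; simp [ht]
  · constructor
    · rintro ⟨h, -⟩; exact absurd h ht
    · rintro ⟨-, h⟩; exact absurd (BranchSum.smallestCell_subset _ _ h) ht

/-- **`dom k t`**: "`A` has at least two vertices and `t` is THE dominating label point". [folklore] -/
theorem sem_dom_iff (hread : RP.StateReads x k.castSucc A col) (hinv : 2 ≤ A.card → EqIn G A col ∧ ConnIn G A col)
    (hN : A.card ≤ N) (t : V) :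
    P.sem x (RP.dom k t) = true ↔ 2 ≤ A.card ∧ t ∈ domSet RP.S RP.hgt (A, col) := by
  by_cases htS : t ∈ RP.S
  · have hk : P.kind (RP.dom k t) = Kind.and := by rw [RP.kind_dom, if_pos htS]
    rw [P.sem_and hk, RP.srcs_dom, if_pos htS]
    simp only [mem_insert, mem_image, mem_filter, forall_eq_or_imp, forall_exists_index, and_imp, wval_inr,
      sem_insel_iff hread hinv hN]
    have hnins : ∀ t', P.sem x (RP.nins k t') = true ↔ ¬ (2 ≤ A.card ∧ t' ∈ BranchSum.smallestCell A col) := by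
      intro t'
      rw [P.sem_nor_singleton (RP.kind_nins k t') (RP.srcs_nins k t'), wval_inr, Bool.not_eq_true',
        ← Bool.not_eq_true, sem_insel_iff hread hinv hN]
    unfold domSet
    simp only [mem_filter, mem_inter]
    constructor
    · rintro ⟨⟨hA, htc⟩, H⟩
      refine ⟨hA, ⟨htc, htS⟩, fun y' hy' hne => ?_⟩
      by_contra hle
      have := H _ y' hy'.2 hne (not_lt.1 hle) rfl
      rw [wval_inr, hnins] at this
      exact this ⟨hA, hy'.1⟩
    · rintro ⟨hA, ⟨htc, -⟩, H⟩
      refine ⟨⟨hA, htc⟩, ?_⟩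
      rintro _ t' ht'S hne hle rfl
      rw [wval_inr, hnins]
      rintro ⟨-, ht'c⟩
      have := H t' ⟨ht'c, ht'S⟩ hne
      omega
  · have hk : P.kind (RP.dom k t) = Kind.or := by rw [RP.kind_dom, if_neg htS]
    rw [P.sem_or hk, RP.srcs_dom, if_neg htS]
    simp only [Finset.notMem_empty, false_and, exists_false, false_iff, not_and]
    intro _ ht
    exact htS ((mem_domSet_iff _ _).1 ht).1.2

/-- **`go k`**: the step condition of `BranchSum.replay`. [folklore] -/
theorem sem_go_iff (hread : RP.StateReads x k.castSucc A col) (hinv : 2 ≤ A.card → EqIn G A col ∧ ConnIn G A col)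
    (hN : A.card ≤ N) : P.sem x (RP.go k) = true ↔ StepCond RP.S RP.hgt (A, col) := by
  rw [P.sem_or (RP.kind_go k), RP.srcs_go, stepCond_iff]
  simp only [mem_image, exists_exists_and_eq_and, wval_inr, sem_dom_iff hread hinv hN]
  constructor
  · rintro ⟨t, -, hA, ht⟩; exact ⟨hA, t, ht⟩
  · rintro ⟨hA, t, ht⟩; exact ⟨t, ((mem_domSet_iff _ _).1 ht).1.2, hA, ht⟩

/-- `ng k`. [folklore] -/
theorem sem_ng_iff (hread : RP.StateReads x k.castSucc A col) (hinv : 2 ≤ A.card → EqIn G A col ∧ ConnIn G A col)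
    (hN : A.card ≤ N) : P.sem x (RP.ng k) = true ↔ ¬ StepCond RP.S RP.hgt (A, col) := by
  rw [P.sem_nor_singleton (RP.kind_ng k) (RP.srcs_ng k), wval_inr, Bool.not_eq_true', ← Bool.not_eq_true,
    sem_go_iff hread hinv hN]

/-- Under the step condition, `dom k u` singles out the chosen point, for EVERY `u`. [folklore] -/
theorem sem_dom_iff_eq (hread : RP.StateReads x k.castSucc A col) (hinv : 2 ≤ A.card → EqIn G A col ∧ ConnIn G A col)
    (hN : A.card ≤ N) (hc : StepCond RP.S RP.hgt (A, col)) (u : V) :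
    P.sem x (RP.dom k u) = true ↔ u = (Finset.card_eq_one.1 hc.2).choose := by
  rw [sem_dom_iff hread hinv hN, mem_domSet_iff_eq hc]
  exact ⟨fun h => h.2, fun h => ⟨hc.1, h⟩⟩

/-- **Order of the individualised colouring** (`ltI`), on the block, under the step condition. [folklore] -/
theorem sem_ltI_iff (hread : RP.StateReads x k.castSucc A col) (hinv : 2 ≤ A.card → EqIn G A col ∧ ConnIn G A col)
    (hN : A.card ≤ N) (hc : StepCond RP.S RP.hgt (A, col)) {a b : V} (ha : a ∈ A) (hb : b ∈ A) :
    P.sem x (RP.ltI k a b) = true ↔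
      BranchSum.indiv col (Finset.card_eq_one.1 hc.2).choose a < BranchSum.indiv col (Finset.card_eq_one.1 hc.2).choose b := by
  rw [P.sem_or (RP.kind_ltI k a b), RP.srcs_ltI, BranchSum.indiv_lt_iff]
  simp only [mem_insert, mem_singleton, exists_eq_or_imp, exists_eq_left, wval_inr, hread.lt_iff a ha b hb]
  rw [P.sem_and (RP.kind_tieD k a b), RP.srcs_tieD]
  simp only [mem_insert, mem_singleton, forall_eq_or_imp, forall_eq, wval_inr, hread.eq_iff a ha b hb,
    sem_dom_iff_eq hread hinv hN hc]
  rw [P.sem_nor_singleton (RP.kind_ndom k a) (RP.srcs_ndom k a), wval_inr, Bool.not_eq_true',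
    ← Bool.not_eq_true, sem_dom_iff_eq hread hinv hN hc]

/-- **Kernel of the individualised colouring** (`eqI`), on the block, under the step condition. [folklore] -/
theorem sem_eqI_iff (hread : RP.StateReads x k.castSucc A col) (hinv : 2 ≤ A.card → EqIn G A col ∧ ConnIn G A col)
    (hN : A.card ≤ N) (hc : StepCond RP.S RP.hgt (A, col)) {a b : V} (ha : a ∈ A) (hb : b ∈ A) :
    P.sem x (RP.eqI k a b) = true ↔
      BranchSum.indiv col (Finset.card_eq_one.1 hc.2).choose a = BranchSum.indiv col (Finset.card_eq_one.1 hc.2).choose b := by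
  rw [P.sem_and (RP.kind_eqI k a b), RP.srcs_eqI, BranchSum.indiv_eq_iff]
  simp only [mem_insert, mem_singleton, forall_eq_or_imp, forall_eq, wval_inr, hread.eq_iff a ha b hb]
  refine and_congr_right fun _ => ?_
  rw [P.sem_or (RP.kind_deqv k a b), RP.srcs_deqv]
  simp only [mem_insert, mem_singleton, exists_eq_or_imp, exists_eq_left, wval_inr]
  rw [P.sem_and (RP.kind_bothD k a b), RP.srcs_bothD, P.sem_nor (RP.kind_noneD k a b), RP.srcs_noneD]
  simp only [mem_insert, mem_singleton, forall_eq_or_imp, forall_eq, wval_inr]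
  have hda := sem_dom_iff_eq hread hinv hN hc a
  have hdb := sem_dom_iff_eq hread hinv hN hc b
  revert hda hdb
  cases P.sem x (RP.dom k a) <;> cases P.sem x (RP.dom k b) <;> simp <;> tauto

end Stage

end ReplayIter

end Summit.PneNP.PneNP.Theorems
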